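import Summits.CriticalPhenomena.PercolationContinuityZ3.Theorems.FK.PressureQDerivatives
import Summits.CriticalPhenomena.PercolationContinuityZ3.Theorems.FK.PressureThermodynamicLimit
import Summits.CriticalPhenomena.PercolationContinuityZ3.Theorems.FK.LatticeEdgeCounting
import Literature.MathematicalPhysics.QuantumFieldTheory.Balaban1983to89.InfiniteVolumeSufficientIII
import HarnessLib

/-!
# FK-continuity cell, FO-10a: at fixed `p`, the random-cluster measure on `ℤ^d` is unique for all but countably many `q`
# (Grimmett 2006, Thm. (4.60)(b) on the vertical line `π = π(p)`, with Lemma (4.79))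

Registered R93 (cell INBOX l.6487, 2026-08-24); registry row FO-10a-g338u; label KQC-A (coordinator fk-4 g196).
Cell `fk-continuity` (bschramm), row FO-10a; support file for the FK-continuity transplant
(`--supports stmt-CriticalPhenomena-4575`); builds on p205010 (kernel theorem, internal audit signed;
external expert review pending). Pure proofs; no definitions, no named facts, no sorries; `d ≥ 1`.

The pressure `G(π,κ)` is jointly convex (`PressureConvexity.lean`), so its section `κ ↦ G(π(p),κ)` is convex on `[0,∞)` and
differentiable off a countable set of `κ` (Literature `countable_not_differentiableAt_of_convexOn`); by Lemma (4.79)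
(`differentiableAt_pressure_q_iff`) non-differentiability in `κ = log q` at `q > 1` is exactly non-uniqueness `φ⁰_{p,q} ≠ φ¹_{p,q}`.
The mirror statement at fixed `q` (countably many `p`) is FO-07b's `countable_setOf_rcLimit_false_ne_rcLimit_true`.

* `convexOn_slice_right` — a section of a jointly convex function is convex;
* HEADLINE **`countable_setOf_rcLimit_false_ne_rcLimit_true_right (hd : 0 < d) (hp : p ∈ Ioo 0 1) :
  {q : ℝ | 1 < q ∧ rcLimit d false p q ≠ rcLimit d true p q}.Countable`**.

## References
* G. Grimmett, *The Random-Cluster Model*, Springer 2006 (`book:grimmett2006-random-cluster-model`): §4.5,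
  Thm. (4.58) (convexity), Thm. (4.60)(b), Lemma (4.79) [PDF pp. 86–88, 93]. [Grimmett2006]
-/

noncomputable section

open scoped Classical
open Finset Filter Topology MeasureTheory Set

namespace Summit.CriticalPhenomena.PercolationContinuityZ3.Theorems.FK

open Literature.Probability.Percolation Literature.Probability.LatticeModels
open Literature.MathematicalPhysics.QuantumFieldTheory.Balaban1983to89.Missing

variable {d : ℕ} {p : ℝ}

/-- A section `κ ↦ G(π₀, κ)` of a function convex on `univ ×ˢ K` is convex on `K`. [folklore] -/
theorem convexOn_slice_right {G : ℝ × ℝ → ℝ} {K : Set ℝ} (hG : ConvexOn ℝ (Set.univ ×ˢ K) G) (π₀ : ℝ) :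
    ConvexOn ℝ K (fun κ => G (π₀, κ)) := by
  refine ⟨fun x hx y hy a b ha hb hab => ?_, fun x hx y hy a b ha hb hab => ?_⟩
  · exact (hG.1 (Set.mk_mem_prod (Set.mem_univ π₀) hx) (Set.mk_mem_prod (Set.mem_univ π₀) hy) ha hb hab).2
  · have h := hG.2 (Set.mk_mem_prod (Set.mem_univ π₀) hx) (Set.mk_mem_prod (Set.mem_univ π₀) hy) ha hb hab
    have e : a • (π₀, x) + b • (π₀, y) = (π₀, a • x + b • y) := by
      ext
      · simp only [Prod.smul_mk, Prod.mk_add_mk, smul_eq_mul]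
        rw [← add_mul, hab, one_mul]
      · simp only [Prod.smul_mk, Prod.mk_add_mk]
    rw [e] at h
    exact h

/-- **Grimmett 2006, Thm. (4.60)(b) on the line `π = π(p)`: at fixed `p ∈ (0,1)` the random-cluster measure on `ℤ^d`
(`d ≥ 1`) is unique, `φ⁰_{p,q} = φ¹_{p,q}`, for all but countably many `q > 1`** — the `κ`-section of the convex pressure
is differentiable off a countable set, and by Lemma (4.79) its non-differentiability at `κ = log q` is non-uniqueness.
[cite: Grimmett2006, Thm. (4.60)(b), Lemma (4.79), Thm. (4.58)] -/
theorem countable_setOf_rcLimit_false_ne_rcLimit_true_right (hd : 0 < d) (hp : p ∈ Set.Ioo (0 : ℝ) 1) :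
    {q : ℝ | 1 < q ∧ rcLimit d false p q ≠ rcLimit d true p q}.Countable := by
  -- the two-parameter pressure `Ψ x y` (per-site limit of the box pressures, both boundary conditions), `x ∈ [0,1]`, `y ≥ 1`
  have hex : ∀ x y : ℝ, ∃ Φ : ℝ, x ∈ Set.Icc (0 : ℝ) 1 → 1 ≤ y → ∀ b : Bool, Tendsto (fun N : ℕ =>
      Real.log (rcPartitionFunction (finsetGraph (zdGraph d) (box d N)) x y (boxBC d b N)) / (#(box d N) : ℝ))
        atTop (𝓝 Φ) := by
    intro x y
    by_cases h : x ∈ Set.Icc (0 : ℝ) 1 ∧ 1 ≤ y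
    · obtain ⟨Φ, -, hΦ⟩ := exists_forall_tendsto_log_rcPartitionFunction_box_div (d := d) h.1 h.2
      exact ⟨Φ, fun _ _ => hΦ⟩
    · exact ⟨0, fun hx hy => (h ⟨hx, hy⟩).elim⟩
  choose Ψ hΨ using hex
  -- joint convexity of `G(π,κ) = Ψ(logistic π, e^κ) − d·log(1 − logistic π)` on `univ × [0,∞)`
  set G : ℝ × ℝ → ℝ := fun x =>
    Ψ (Real.exp x.1 / (1 + Real.exp x.1)) (Real.exp x.2) - d * Real.log (1 - Real.exp x.1 / (1 + Real.exp x.1)) with hG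
  have hconv : ConvexOn ℝ (Set.univ ×ˢ Set.Ici (0 : ℝ)) G :=
    convexOn_pressure_logistic_exp (convex_Ici 0) (b := false)
      (fun π κ hκ => hΨ _ _ ⟨(logistic_mem_Ioo π).1.le, (logistic_mem_Ioo π).2.le⟩
        (by simpa using Real.one_le_exp (Set.mem_Ici.1 hκ)) false)
      tendsto_card_edgeFinset_box_div_card_box
  -- its section at `π₀ = log(p/(1-p))`, where `logistic π₀ = p`
  set π₀ : ℝ := Real.log (p / (1 - p)) with hπ₀
  have hlogi : Real.exp π₀ / (1 + Real.exp π₀) = p := by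
    have h1p : 0 < 1 - p := sub_pos.2 hp.2
    rw [hπ₀, Real.exp_log (div_pos hp.1 h1p)]
    field_simp
    ring
  set g : ℝ → ℝ := fun κ => G (π₀, κ) with hg
  have hgconv : ConvexOn ℝ (Set.Ici (0 : ℝ)) g := convexOn_slice_right hconv π₀
  have hgeq : ∀ κ : ℝ, g κ = Ψ p (Real.exp κ) - d * Real.log (1 - p) := by
    intro κ; simp only [hg, hG, hlogi]
  -- countably many non-differentiability points of `g` in `(0,∞)`
  have hcount : {κ ∈ interior (Set.Ici (0 : ℝ)) | ¬ DifferentiableAt ℝ g κ}.Countable :=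
    countable_not_differentiableAt_of_convexOn hgconv
  rw [interior_Ici] at hcount
  refine ((hcount.image Real.exp).mono ?_)
  rintro q ⟨hq1, hne⟩
  have hq0 : 0 < q := one_pos.trans hq1
  refine ⟨Real.log q, ⟨Set.mem_Ioi.2 (Real.log_pos hq1), fun hdiff => hne ?_⟩, Real.exp_log hq0⟩
  -- differentiability of `g` at `log q` gives differentiability of `Ψ p` at `q`
  have hΦ : ∀ b : Bool, ∀ᶠ y in 𝓝 q, Tendsto (fun N : ℕ =>
      Real.log (rcPartitionFunction (finsetGraph (zdGraph d) (box d N)) p y (boxBC d b N)) / #(box d N)) atTop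
        (𝓝 (Ψ p y)) := fun b => by
    filter_upwards [eventually_ge_nhds hq1] with y hy
    exact hΨ p y ⟨hp.1.le, hp.2.le⟩ hy b
  refine (differentiableAt_pressure_q_iff hd hp hq1 hΦ).1 ?_
  -- `Ψ p = (g ∘ log) + const` near `q`
  have hdg : DifferentiableAt ℝ (fun y => g (Real.log y) + d * Real.log (1 - p)) q :=
    ((hdiff.comp q (Real.differentiableAt_log hq0.ne'))).add_const _
  refine hdg.congr_of_eventuallyEq ?_
  filter_upwards [eventually_gt_nhds hq0] with y hy
  simp only [hgeq, Real.exp_log hy]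
  ring

end Summit.CriticalPhenomena.PercolationContinuityZ3.Theorems.FK

end
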